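import Summits.Ventures.PercRepro.S2IndepFiveCount

/-!
# PercRepro — S2: THE INDEPENDENT `q`-SETS ARE FEWER THAN `C(n, q)` BY THE TRIANGLES, EVERY `q ≥ 5` (p7, gen 4; sub-claim S2; offered to S3 / S1)

S2IndepFiveCount's correction at every level: every triangle `T` (a `3`-circuit) and every `(q − 3)`-subset `P` of `E ∖ T`
give a DEPENDENT `q`-set `T ∪ P`, so `s₃·C(n − 3, q − 3) ≤ Σ_{B dependent q-set} #{triangles inside B}`; with
`f ≤ 1 + C(f, 2)` the sum is at most `#{dependent q-sets}` plus the number of pairs `(B, {T, T′})` of a dependent `q`-set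
and two distinct triangles inside it; under (C1) two distinct triangles share at most one point, so `T ∪ T′` has at
least `5` points and lies in at most `C(n − 5, q − 5)` of the `q`-subsets. Hence

  **`#{independent q-sets} + s₃·C(n − 3, q − 3) ≤ C(n, q) + C(s₃, 2)·C(n − 5, q − 5)`** (`ncard_indep_add_le`, `5 ≤ q`).

At `q = 5` this is S2IndepFiveCount's bound (the overlap term `C(s₃, 2)`); at `q = 6` each triangle removes `C(n − 3, 3)`
six-subsets against an overlap of `C(s₃, 2)·(n − 5)` — the level-`6` count's first term (S3, p8) drops by several per cent
of the cell with no new matroid theory. Axioms: standard.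
-/

open scoped Matroid

namespace PercRepro

namespace S2

open Set Finset

variable {α : Type} {M : Matroid α}

open scoped Classical in
/-- The `q`-subsets of a finset `Ef` containing a fixed subset `U` of `Ef` with `|U| = u` number at most `C(|Ef| − u, q − u)`. -/
theorem card_powersetCard_filter_subset_le (Ef U : Finset α) (hU : U ⊆ Ef) (q : ℕ) :
    ((Ef.powersetCard q).filter (fun B => U ⊆ B)).card ≤ (Ef.card - U.card).choose (q - U.card) := by
  have hc : ((Ef \ U).powersetCard (q - U.card)).card = (Ef.card - U.card).choose (q - U.card) := by
    rw [Finset.card_powersetCard, Finset.card_sdiff, Finset.inter_eq_left.2 hU]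
  rw [← hc]
  apply Finset.card_le_card_of_injOn (fun B => B \ U)
  · intro B hB
    rw [Finset.mem_coe, Finset.mem_filter, Finset.mem_powersetCard] at hB
    rw [Finset.mem_coe, Finset.mem_powersetCard]
    refine ⟨fun x hx => ?_, ?_⟩
    · rw [Finset.mem_sdiff] at hx ⊢
      exact ⟨hB.1.1 hx.1, hx.2⟩
    · rw [Finset.card_sdiff, Finset.inter_eq_left.2 hB.2, hB.1.2]
  · intro B hB B' hB' h
    simp only at h
    rw [Finset.mem_coe, Finset.mem_filter] at hB hB'
    ext x
    constructor
    · intro hx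
      by_cases hxU : x ∈ U
      · exact hB'.2 hxU
      · have : x ∈ B \ U := Finset.mem_sdiff.2 ⟨hx, hxU⟩
        rw [h] at this
        exact (Finset.mem_sdiff.1 this).1
    · intro hx
      by_cases hxU : x ∈ U
      · exact hB.2 hxU
      · have : x ∈ B' \ U := Finset.mem_sdiff.2 ⟨hx, hxU⟩
        rw [← h] at this
        exact (Finset.mem_sdiff.1 this).1

open scoped Classical in
/-- **The independent `q`-sets against the triangles, every `q ≥ 5`**:
`#{independent q-sets} + s₃·C(n − 3, q − 3) ≤ C(n, q) + C(s₃, 2)·C(n − 5, q − 5)` (`n = |E|`), under (C1). -/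
theorem ncard_indep_add_le [M.Finite] (hC1 : ∀ L ⊆ M.E, M.eRk L = 2 → L.ncard ≤ 3) (q : ℕ) (hq : 5 ≤ q) :
    {B : Set α | B ⊆ M.E ∧ B.ncard = q ∧ M.eRk B = q}.ncard +
      {C : Set α | M.IsCircuit C ∧ C.ncard = 3}.ncard * (M.E.ncard - 3).choose (q - 3) ≤
      M.E.ncard.choose q + ({C : Set α | M.IsCircuit C ∧ C.ncard = 3}.ncard).choose 2 * (M.E.ncard - 5).choose (q - 5) := by
  classical
  set Ef := Matroid.groundF M with hEf
  have hE : (Ef : Set α) = M.E := Matroid.coe_groundF M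
  have hEcard : Ef.card = M.E.ncard := Matroid.card_groundF M
  -- the triangles, as finsets
  set T3 : Finset (Finset α) := (Ef.powersetCard 3).filter (fun C : Finset α => M.IsCircuit (C : Set α)) with hT3def
  have hT3mem : ∀ T ∈ T3, M.IsCircuit (T : Set α) ∧ T.card = 3 := by
    intro T hT
    rw [hT3def, Finset.mem_filter, Finset.mem_powersetCard] at hT
    exact ⟨hT.2, hT.1.2⟩
  have hT3E : ∀ T ∈ T3, T ⊆ Ef := by
    intro T hT
    rw [hT3def, Finset.mem_filter, Finset.mem_powersetCard] at hT
    exact hT.1.1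
  have hT3card : T3.card = {C : Set α | M.IsCircuit C ∧ C.ncard = 3}.ncard := by
    rw [← Matroid.card_circF]
    have himg : Matroid.circF M 3 = T3.image (fun s : Finset α => (s : Set α)) := by
      ext C
      rw [Matroid.mem_circF, Finset.mem_image]
      constructor
      · rintro ⟨hC, hC3⟩
        have hCfin : C.Finite := M.ground_finite.subset hC.subset_ground
        refine ⟨hCfin.toFinset, ?_, by simp⟩
        rw [hT3def, Finset.mem_filter, Finset.mem_powersetCard]
        refine ⟨⟨?_, ?_⟩, by simpa using hC⟩
        · intro x hx
          rw [Set.Finite.mem_toFinset] at hx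
          rw [hEf, Matroid.groundF, Set.Finite.mem_toFinset]
          exact hC.subset_ground hx
        · rw [← Set.ncard_eq_toFinset_card C hCfin]; exact hC3
      · rintro ⟨s, hs, rfl⟩
        obtain ⟨hsc, hs3⟩ := hT3mem s hs
        exact ⟨hsc, by rw [Set.ncard_coe_finset]; exact hs3⟩
    rw [himg, Finset.card_image_of_injective _ Finset.coe_injective]
  -- the pairs `(T, P)`: a triangle and a `(q − 3)`-subset of `E ∖ T`
  set Pairs : Finset (Σ _ : Finset α, Finset α) := T3.sigma (fun T => (Ef \ T).powersetCard (q - 3)) with hPairsdef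
  have hPairscard : Pairs.card = T3.card * (Ef.card - 3).choose (q - 3) := by
    rw [hPairsdef, Finset.card_sigma]
    have : ∀ T ∈ T3, ((Ef \ T).powersetCard (q - 3)).card = (Ef.card - 3).choose (q - 3) := by
      intro T hT
      rw [Finset.card_powersetCard, Finset.card_sdiff, Finset.inter_eq_left.2 (hT3E T hT), (hT3mem T hT).2]
    rw [Finset.sum_congr rfl this, Finset.sum_const, smul_eq_mul]
  -- the dependent and the independent `q`-subsets
  set Dq : Finset (Finset α) := (Ef.powersetCard q).filter (fun B : Finset α => ¬ M.Indep (B : Set α)) with hDqdef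
  set Iq : Finset (Finset α) := (Ef.powersetCard q).filter (fun B : Finset α => M.Indep (B : Set α)) with hIqdef
  have hID : Iq.card + Dq.card = Ef.card.choose q := by
    rw [hIqdef, hDqdef, Finset.card_filter_add_card_filter_not, Finset.card_powersetCard]
  -- the map `(T, P) ↦ T ∪ P` lands in the dependent `q`-sets
  have hmaps : ∀ x ∈ Pairs, x.1 ∪ x.2 ∈ Dq := by
    intro x hx
    rw [hPairsdef, Finset.mem_sigma, Finset.mem_powersetCard] at hx
    obtain ⟨hx1, hx2, hx2c⟩ := hx
    obtain ⟨hc, h3⟩ := hT3mem _ hx1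
    have hdisj : Disjoint x.1 x.2 := by
      rw [Finset.disjoint_left]
      intro a ha ha'
      exact (Finset.mem_sdiff.1 (hx2 ha')).2 ha
    rw [hDqdef, Finset.mem_filter, Finset.mem_powersetCard]
    refine ⟨⟨Finset.union_subset (hT3E _ hx1) (hx2.trans Finset.sdiff_subset), ?_⟩, ?_⟩
    · rw [Finset.card_union_of_disjoint hdisj, h3, hx2c]; omega
    · intro hind
      have : M.Indep (x.1 : Set α) := hind.subset (by rw [Finset.coe_union]; exact Set.subset_union_left)
      exact hc.not_indep this
  -- the fibre over `B` injects into the triangles inside `B`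
  have hfib : ∀ B ∈ Dq, (Pairs.filter (fun x => x.1 ∪ x.2 = B)).card ≤ (T3.filter (fun T => T ⊆ B)).card := by
    intro B _
    apply Finset.card_le_card_of_injOn (fun x => x.1)
    · intro x hx
      rw [Finset.mem_coe, Finset.mem_filter] at hx
      rw [Finset.mem_coe, Finset.mem_filter]
      refine ⟨?_, ?_⟩
      · rw [hPairsdef, Finset.mem_sigma] at hx
        exact hx.1.1
      · rw [← hx.2]; exact Finset.subset_union_left
    · intro x hx y hy hxy
      simp only at hxy
      rw [Finset.mem_coe, Finset.mem_filter] at hx hy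
      have hx' := hx.1
      have hy' := hy.1
      rw [hPairsdef, Finset.mem_sigma, Finset.mem_powersetCard] at hx' hy'
      have h2 : x.2 = y.2 := by
        have ex : x.2 = B \ x.1 := by
          rw [← hx.2]
          ext a
          rw [Finset.mem_sdiff, Finset.mem_union]
          constructor
          · intro ha
            exact ⟨Or.inr ha, (Finset.mem_sdiff.1 (hx'.2.1 ha)).2⟩
          · rintro ⟨h, h'⟩
            rcases h with h | h
            · exact absurd h h'
            · exact h
        have ey : y.2 = B \ y.1 := by
          rw [← hy.2]
          ext a
          rw [Finset.mem_sdiff, Finset.mem_union]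
          constructor
          · intro ha
            exact ⟨Or.inr ha, (Finset.mem_sdiff.1 (hy'.2.1 ha)).2⟩
          · rintro ⟨h, h'⟩
            rcases h with h | h
            · exact absurd h h'
            · exact h
        rw [ex, ey, hxy]
      exact Sigma.ext hxy (heq_of_eq h2)
  -- `f ≤ 1 + C(f, 2)`: the triangles inside `B` against the pairs of triangles inside `B`
  have hf : ∀ f : ℕ, f ≤ 1 + f.choose 2 := by
    intro f
    rcases f with _ | _ | k
    · simp
    · simp
    · have h1 : k + 1 ≤ (k + 1 + 1).choose 2 := by
        rw [Nat.choose_two_right, show k + 1 + 1 - 1 = k + 1 by omega, Nat.le_div_iff_mul_le (by norm_num)]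
        nlinarith
      omega
  -- the pairs `(B, {T, T′})` of a dependent `q`-set and two distinct triangles inside it
  have hpairs : ∑ B ∈ Dq, ((T3.filter (fun T => T ⊆ B)).card).choose 2 ≤
      T3.card.choose 2 * (Ef.card - 5).choose (q - 5) := by
    have hswap : ∑ B ∈ Dq, ((T3.filter (fun T => T ⊆ B)).card).choose 2 =
        ∑ S ∈ T3.powersetCard 2, (Dq.filter (fun B => ∀ T ∈ S, T ⊆ B)).card := by
      calc ∑ B ∈ Dq, ((T3.filter (fun T => T ⊆ B)).card).choose 2
          = ∑ B ∈ Dq, ((T3.filter (fun T => T ⊆ B)).powersetCard 2).card := by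
            apply Finset.sum_congr rfl
            intro B _
            rw [Finset.card_powersetCard]
        _ = ∑ B ∈ Dq, ((T3.powersetCard 2).filter (fun S => ∀ T ∈ S, T ⊆ B)).card := by
            apply Finset.sum_congr rfl
            intro B _
            congr 1
            ext S
            rw [Finset.mem_powersetCard, Finset.mem_filter, Finset.mem_powersetCard]
            constructor
            · rintro ⟨hS, hS2⟩
              refine ⟨⟨fun T hT => (Finset.mem_filter.1 (hS hT)).1, hS2⟩, fun T hT => (Finset.mem_filter.1 (hS hT)).2⟩
            · rintro ⟨⟨hS, hS2⟩, hall⟩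
              exact ⟨fun T hT => Finset.mem_filter.2 ⟨hS hT, hall T hT⟩, hS2⟩
        _ = ∑ S ∈ T3.powersetCard 2, (Dq.filter (fun B => ∀ T ∈ S, T ⊆ B)).card := by
            simp only [Finset.card_eq_sum_ones, Finset.sum_filter]
            exact Finset.sum_comm
    rw [hswap, ← smul_eq_mul, ← Finset.card_powersetCard 2 T3, ← Finset.sum_const]
    apply Finset.sum_le_sum
    intro S hS
    rw [Finset.mem_powersetCard] at hS
    obtain ⟨T₁, T₂, hne, rfl⟩ := Finset.card_eq_two.1 hS.2
    have hT₁ : T₁ ∈ T3 := hS.1 (by simp)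
    have hT₂ : T₂ ∈ T3 := hS.1 (by simp)
    obtain ⟨hc1, h31⟩ := hT3mem _ hT₁
    obtain ⟨hc2, h32⟩ := hT3mem _ hT₂
    have hi := card_inter_le_one_of_triangles hC1 hc1 h31 hc2 h32 hne
    have hu := Finset.card_union_add_card_inter T₁ T₂
    have hU5 : 5 ≤ (T₁ ∪ T₂).card := by omega
    have hUE : T₁ ∪ T₂ ⊆ Ef := Finset.union_subset (hT3E _ hT₁) (hT3E _ hT₂)
    -- the `q`-sets containing `T₁ ∪ T₂` are among those containing a `5`-subset of it: `≤ C(n − 5, q − 5)`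
    obtain ⟨U5, hU5sub, hU5card⟩ := Finset.exists_subset_card_eq hU5
    have hU5E : U5 ⊆ Ef := hU5sub.trans hUE
    have hsub : Dq.filter (fun B => ∀ T ∈ ({T₁, T₂} : Finset (Finset α)), T ⊆ B) ⊆
        (Ef.powersetCard q).filter (fun B => U5 ⊆ B) := by
      intro B hB
      rw [Finset.mem_filter] at hB
      rw [Finset.mem_filter]
      refine ⟨(Finset.mem_filter.1 hB.1).1, hU5sub.trans (Finset.union_subset (hB.2 T₁ (by simp)) (hB.2 T₂ (by simp)))⟩
    calc (Dq.filter (fun B => ∀ T ∈ ({T₁, T₂} : Finset (Finset α)), T ⊆ B)).card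
        ≤ ((Ef.powersetCard q).filter (fun B => U5 ⊆ B)).card := Finset.card_le_card hsub
      _ ≤ (Ef.card - U5.card).choose (q - U5.card) := card_powersetCard_filter_subset_le Ef U5 hU5E q
      _ = (Ef.card - 5).choose (q - 5) := by rw [hU5card]
  -- the double count
  have hsum : Pairs.card ≤ ∑ B ∈ Dq, (T3.filter (fun T => T ⊆ B)).card := by
    rw [Finset.card_eq_sum_card_fiberwise hmaps]
    exact Finset.sum_le_sum hfib
  have hsum2 : ∑ B ∈ Dq, (T3.filter (fun T => T ⊆ B)).card ≤
      Dq.card + ∑ B ∈ Dq, ((T3.filter (fun T => T ⊆ B)).card).choose 2 := by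
    calc ∑ B ∈ Dq, (T3.filter (fun T => T ⊆ B)).card
        ≤ ∑ B ∈ Dq, (1 + ((T3.filter (fun T => T ⊆ B)).card).choose 2) := Finset.sum_le_sum (fun B _ => hf _)
      _ = Dq.card + ∑ B ∈ Dq, ((T3.filter (fun T => T ⊆ B)).card).choose 2 := by
          rw [Finset.sum_add_distrib, Finset.sum_const, smul_eq_mul, mul_one]
  -- the independent `q`-sets as a set of sets
  have hIqset : {B : Set α | B ⊆ M.E ∧ B.ncard = q ∧ M.eRk B = q}.ncard = Iq.card := by
    have himg : {B : Set α | B ⊆ M.E ∧ B.ncard = q ∧ M.eRk B = q} =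
        Iq.image (fun s : Finset α => (s : Set α)) := by
      ext B
      rw [Set.mem_setOf_eq, Finset.coe_image, Set.mem_image]
      constructor
      · rintro ⟨hBE, hBq, hBr⟩
        have hBfin : B.Finite := M.ground_finite.subset hBE
        refine ⟨hBfin.toFinset, ?_, by simp⟩
        rw [Finset.mem_coe, hIqdef, Finset.mem_filter, Finset.mem_powersetCard]
        refine ⟨⟨?_, ?_⟩, ?_⟩
        · intro x hx
          rw [Set.Finite.mem_toFinset] at hx
          rw [hEf, Matroid.groundF, Set.Finite.mem_toFinset]
          exact hBE hx
        · rw [← Set.ncard_eq_toFinset_card B hBfin]; exact hBq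
        · rw [Set.Finite.coe_toFinset]
          rw [Matroid.indep_iff_eRk_eq_encard_of_finite hBfin, hBr, ← hBfin.cast_ncard_eq, hBq]
      · rintro ⟨s, hs, rfl⟩
        rw [Finset.mem_coe, hIqdef, Finset.mem_filter, Finset.mem_powersetCard] at hs
        refine ⟨?_, by rw [Set.ncard_coe_finset]; exact hs.1.2, ?_⟩
        · rw [← hE]; exact Finset.coe_subset.2 hs.1.1
        · rw [hs.2.eRk_eq_encard, Set.encard_coe_eq_coe_finsetCard, hs.1.2]
    rw [himg, Finset.coe_image, Set.ncard_image_of_injective _ Finset.coe_injective, Set.ncard_coe_finset]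
  rw [hIqset, ← hT3card, ← hEcard]
  have := hPairscard ▸ hsum.trans (hsum2.trans (Nat.add_le_add_left hpairs _))
  omega

end S2

end PercRepro
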